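import Summits.Parity.GeneralizedHardyLittlewood.Theses.EntropyRate

/-!
# Crux attack gen 1 — `EntropyRate.UniformEntropyRate` (stmt-Parity-17876): reading + suggested re-typing

`blockEnt X M` = the empirical Shannon entropy (nats) of the Liouville sign word of length `M`,
`n` uniform in `[0, X)` — exactly the `ent` of the route decl (certified by `uniformEntropyRate_iff`,
which is `Iff.rfl`).  `UniformEntropyRateLogK` is the SUGGESTED RE-TYPING for the planner: the
dilation factor `k` must be allowed to grow like `log H` (Tao 2016 p.12: `H_{j+1} = H_j ⌊C₀ log H_j
log log log H_j⌋`; Tao–Teräväinen 2019 §5 p.26 needs `I(X:Y) ≤ ε⁵ 2^m / m`), because Tao's inequality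
`I(X_H,Y_H) ≤ H [h(H) − h(kH)] + O(H/k)` only yields `o(H / log H)` when `k ≫ log H`; with `k` fixed
BEFORE `H` (as typed) the `O(H/k)` term is not `o(H/log H)`.  Any `k_H` of polylog size keeps the
route's own reduction `convergence of h_X(M) for each M ⟹ door` (pigeonhole along `M_{j+1} = k_{M_j} M_j`,
`Σ_j 1/log M_j = Σ 1/(j log j) = ∞`) and the implications from Chowla / few sign patterns.
-/

namespace Summit.Parity.GeneralizedHardyLittlewood.Cruxes.UniformEntropyRate.Attack

open Summit.Parity.GeneralizedHardyLittlewood.Theses.EntropyRate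

/-- Empirical block entropy (nats) of the Liouville sign word `(λ(n+1),…,λ(n+M))`, `n` uniform in `[0,X)`. -/
noncomputable def blockEnt (X M : ℕ) : ℝ :=
  ∑ w : Fin M → Bool, Real.negMulLog
    (((((Finset.range X).filter (fun n : ℕ => ∀ j : Fin M,
      (ArithmeticFunction.liouville (n + 1 + (j : ℕ)) = 1 ↔ w j = true))).card : ℕ) : ℝ) / X)

/-- The route decl, read through `blockEnt` (definitional). -/
theorem uniformEntropyRate_iff :
    UniformEntropyRate ↔
      ∀ ε : ℝ, 0 < ε → ∀ k : ℕ, 2 ≤ k → ∀ H₁ : ℕ, ∃ H : ℕ, H₁ ≤ H ∧ 2 ≤ H ∧ ∃ X₀ : ℕ, ∀ X : ℕ, X₀ ≤ X →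
        blockEnt X H / H - blockEnt X (k * H) / ((k * H : ℕ) : ℝ) ≤ ε / Real.log H :=
  Iff.rfl

/-- SUGGESTED RE-TYPING (k tied to H, polylog growth; `3 ≤ H` makes `k ≥ 2`). -/
def UniformEntropyRateLogK : Prop :=
  ∀ ε : ℝ, 0 < ε → ∀ H₁ : ℕ, ∃ H : ℕ, H₁ ≤ H ∧ 3 ≤ H ∧ ∃ X₀ : ℕ, ∀ X : ℕ, X₀ ≤ X →
    blockEnt X H / H - blockEnt X (⌈(Real.log H) ^ 2⌉₊ * H) / ((⌈(Real.log H) ^ 2⌉₊ * H : ℕ) : ℝ)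
      ≤ ε / Real.log H

/-- The same re-typing as a ONE-LINE Prop term in the route's own `let` style (for `route edit`). -/
def UniformEntropyRateLogK' : Prop :=
  ∀ ε : ℝ, 0 < ε → ∀ H₁ : ℕ, ∃ H : ℕ, H₁ ≤ H ∧ 3 ≤ H ∧ ∃ X₀ : ℕ, ∀ X : ℕ, X₀ ≤ X → let freq : (M : ℕ) → (Fin M → Bool) → ℝ := fun M w => ((((Finset.range X).filter (fun n : ℕ => ∀ j : Fin M, (ArithmeticFunction.liouville (n + 1 + (j : ℕ)) = 1 ↔ w j = true))).card : ℕ) : ℝ) / X; let ent : ℕ → ℝ := fun M => ∑ w : Fin M → Bool, Real.negMulLog (freq M w); let k : ℕ := ⌈(Real.log H) ^ 2⌉₊; ent H / H - ent (k * H) / ((k * H : ℕ) : ℝ) ≤ ε / Real.log H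

theorem uniformEntropyRateLogK'_iff : UniformEntropyRateLogK' ↔ UniformEntropyRateLogK := Iff.rfl

/-- Variant with an arbitrary fixed power of `log H` (also fine for the consumer and for the pigeonhole). -/
def UniformEntropyRatePolylogK : Prop :=
  ∀ ε : ℝ, 0 < ε → ∀ A : ℕ, 1 ≤ A → ∀ H₁ : ℕ, ∃ H : ℕ, H₁ ≤ H ∧ 3 ≤ H ∧ ∃ X₀ : ℕ, ∀ X : ℕ, X₀ ≤ X →
    blockEnt X H / H - blockEnt X (⌈(Real.log H) ^ (A + 1)⌉₊ * H) / ((⌈(Real.log H) ^ (A + 1)⌉₊ * H : ℕ) : ℝ)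
      ≤ ε / Real.log H

-- degenerate-parameter facts used in the report
example : Real.log ((2 : ℕ) : ℝ) > 0 := by
  have : (1 : ℝ) < ((2 : ℕ) : ℝ) := by norm_num
  exact Real.log_pos this

/-- At `X = 0` every frequency is `0/0 = 0`, so `blockEnt 0 M = 0` (the `∃ X₀` makes this harmless). -/
example (M : ℕ) : blockEnt 0 M = 0 := by
  simp [blockEnt]

end Summit.Parity.GeneralizedHardyLittlewood.Cruxes.UniformEntropyRate.Attack
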